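import Literature.NumberTheory.GaloisRepresentations.AlgebraicHeckeCharacterGrossencharakterProofs
import HarnessLib

/-!
# Neukirch's Größencharakter relation for an ARBITRARY Hecke character:
# `χ((a)_∞) · χ̃((a)) = 1` on the ray `a ≡ 1 mod 𝔪` (proof file)

Topic `NumberTheory/GaloisRepresentations`; namespace
`Literature.NumberTheory.GaloisRepresentations.HeckeCharacter`.  Proof file (theorems only: no
definition, no named fact, no instance; D-0026), sequel of `HeckeCharacterDictionary.lean`
(`map_principalIdele_eq`, `isRayClassCharacter_of_isModulus` — the FINITE-ORDER case) and of
`AlgebraicHeckeCharacterGrossencharakterProofs.lean` (`HasInfinityType.idealPow_span_eq` — the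
ALGEBRAIC case, where the archimedean factor is evaluated through the infinity type).  Here the
character `χ : HeckeCharacter K` is ARBITRARY (a continuous quasi-character of `𝕀_K/Kˣ`, neither
unitarity nor an infinity type assumed) and the archimedean factor is kept as the raw value
`χ((a)_∞)` of `χ` on the infinite part `(a)_∞ = infiniteIdeles K (globalToInfiniteUnits K a)` of the
principal idele.

THE PRINTED STATEMENT.  Neukirch, *Algebraic Number Theory*, Ch. VII §6, Prop. (6.13) and its proof
(held copy `book:bynd-algebraic-number-theory`, chunks p0423–p0425): for a Hecke character `χ` with
module of definition `𝔪` one has the homomorphisms `c : J^𝔪 → C(𝔪)` (`𝔭 ↦ ⟨π_𝔭⟩`),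
`φ : (𝒪/𝔪)^* → C(𝔪)` (`a ↦ â a_∞`), `ψ : 𝐑^*/𝒪^𝔪 → C(𝔪)` (`b ↦ b⁻¹`) and, for every `a ∈ K^{(𝔪)}`,
**`f(δ(a)) = c((a))⁻¹ φ(a) ψ(a) = â⁻¹ · â a_∞ · a_∞⁻¹ = 1`**, whence (p0425) the triple
`(χ ∘ c, χ_f, χ_∞)` satisfies `χ((a))⁻¹ χ_f(a mod 𝔪) χ_∞(a mod 𝒪^𝔪) = 1` for `a ∈ K^{(𝔪)}` — this makes
`χ ∘ c` "a *Größencharakter* mod `𝔪`" ((6.14) Corollary).  Since `χ_f(a) = 1` for `a ≡ 1 mod 𝔪`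
("for `a ∈ 𝒪`, `a ≡ 1 mod 𝔪`, we have `a_f â⁻¹ ∈ I_f^𝔪`, so … `φ(a) = [â a_∞] = [a] = 1`", p0424) and
`χ_∞ = (χ|_{I_∞})⁻¹` (`ψ(b) = b⁻¹`), on the ray this reads **`χ̃((a)) = χ((a)_∞)⁻¹`**.

In the tree's vocabulary: `χ̃(𝔞) = LFunctions.idealPow K (fun v => χ.valueAtUniformizer v) 𝔞 =
∏_𝔭 χ(ϖ_𝔭)^{v_𝔭(𝔞)}`, a module of definition is `HeckeCharacter.IsModulus χ T e` with ideal
`𝔪 = modulusIdeal T e = ∏_{v ∈ T} 𝔭_v^{e_v + 1}` (every `χ` has one: `exists_isModulus`,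
`exists_isModulus_of_ramified`), and:

* §1 `IsModulus.coe_apply_infiniteIdeles_mul_idealPow_span_eq` — for nonzero integers `b ≡ c mod 𝔪`,
  `c` prime to `𝔪`: `χ((b)_∞) · χ̃((b)) = χ((c)_∞) · χ̃((c))` (Neukirch's proof verbatim, as already
  formalised twice in the tree: the local factors at `T` agree, those off `T` are `χ(ϖ_𝔭)^{v_𝔭}`;
  NO positivity condition — the infinite parts are not evaluated);
* §2 `IsModulus.coe_apply_infiniteIdeles_mul_idealPow_span_eq_one` — on the ray `a ≡ 1 mod 𝔪`:
  **`χ((a)_∞) · χ̃((a)) = 1`** ((6.13): `f ∘ δ = 1`);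
* §3 `IsModulus.exists_pos_forall_pow_coe_apply_infiniteIdeles_mul_idealPow_eq_one` — for every
  nonzero `a` PRIME TO `𝔪`: `(χ((a)_∞) · χ̃((a)))^M = 1` with `M = #(𝒪_K/𝔪)ˣ` (`a^M ≡ 1 mod 𝔪`; the
  form in which Weil 1956 §1 / the tree's `HeckeCharacterArchTypeProofs` §1 use (6.13) for units);
* §4 `IsModulus.pow_coe_apply_infiniteIdeles_mul_valueAtUniformizer_eq_one` — at a PRINCIPAL prime
  `𝔭_w = (π)` off `T`: `(χ((π)_∞) · χ(ϖ_w))^M = 1`, i.e. the Euler coefficient `χ(ϖ_w)` is the inverse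
  archimedean value `χ((π)_∞)⁻¹` up to an `M`-th root of unity (and EQUALS it when `π ≡ 1 mod 𝔪`,
  `coe_apply_infiniteIdeles_mul_valueAtUniformizer_eq_one`).

Consumer: the rigidity programme (Rig) of cell bsd-cm (K7r item 19945, D144 (b2′) step
"`φ(v) = Φ(σϖ_v) · ε_φ(ϖ_v)`, `ε_φ` of finite order `M`"), for `K = ℚ(√−7)` (`h_K = 1`: every prime is
principal) and an ARBITRARY `L`-pinned `φ : HeckeCharacter K`; the archimedean value `χ((π)_∞)` is
then read through `infiniteIdeles_eq_prod_infiniteIdeleSingle` / `HeckeCharacter.archComponent` and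
`Automorphic.exists_hasComplexParam_of_continuous` (all in the tree).

## References

* J. Neukirch, *Algebraic Number Theory*, Grundlehren 322, Springer 1999, Ch. VII §6, Def. (6.11),
  Prop. (6.12), Prop. (6.13) with proof, Cor. (6.14). [NeukirchANT1999]
* A. Weil, *On a certain type of characters of the idèle-class group of an algebraic
  number-field*, Proc. Int. Symp. Tokyo–Nikko 1955 (1956), 1–7, §1. [Weil1956]
-/

noncomputable section

open scoped NumberField Classical
open NumberField IsDedekindDomain IsDedekindDomain.HeightOneSpectrum

namespace Literature.NumberTheory.GaloisRepresentations

universe u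

variable {K : Type u} [Field K] [NumberField K]

namespace HeckeCharacter

/-! ### §1. Neukirch (6.13) for two congruent integers -/

/-- **Neukirch VII (6.13) for an arbitrary Hecke character, two congruent integers.**  Let `χ` be a
Hecke character of `K` with module of definition `(T, e)` (`𝔪 = ∏_{v ∈ T} 𝔭_v^{e_v+1}`), and
`χ̃(𝔞) = ∏_𝔭 χ(ϖ_𝔭)^{v_𝔭(𝔞)}` (`LFunctions.idealPow`).  For nonzero integers `b, c` with `c` prime to
`𝔪` and `b ≡ c mod 𝔪`: `χ((b)_∞) · χ̃((b)) = χ((c)_∞) · χ̃((c))`.  Proof = Neukirch's decomposition of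
the principal ideles `b`, `c` (`map_principalIdele_eq`): `χ((b)_∞) ∏_{v ∈ T} χ(⟨b⟩_v) ∏_{v ∉ T} χ(⟨b⟩_v)
= 1`, the factors at `T` agree for `b` and `c` (`b/c ∈ U_𝔭^{(e_𝔭+1)}`,
`map_prod_localUnits_eq_one_of_isModulus`), and off `T` `χ(⟨b⟩_v) = χ(ϖ_v)^{v_𝔭(b)}`
(`IsUnramifiedAt.coe_map_localUnits_eq_zpow`).  No positivity hypothesis: the infinite parts are not
evaluated (compare `HasInfinityType.idealPow_span_eq`, `isRayClassCharacter_of_isModulus`).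
[cite: NeukirchANT1999, Ch. VII §6 Prop. (6.13) (proof) and Cor. (6.14)] -/
theorem IsModulus.coe_apply_infiniteIdeles_mul_idealPow_span_eq {χ : HeckeCharacter K}
    {T : Finset (HeightOneSpectrum (𝓞 K))} {e : HeightOneSpectrum (𝓞 K) → ℕ} (hmod : IsModulus χ T e)
    {b c : 𝓞 K} (hb : (b : K) ≠ 0) (hc : (c : K) ≠ 0)
    (hcop : IsCoprime (Ideal.span {c}) (modulusIdeal T e)) (hbc : b - c ∈ modulusIdeal T e) :
    (χ (infiniteIdeles K (globalToInfiniteUnits K (Units.mk0 (b : K) hb))) : ℂ) *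
        LFunctions.idealPow K (fun v => χ.valueAtUniformizer v) (Ideal.span {b}) =
      (χ (infiniteIdeles K (globalToInfiniteUnits K (Units.mk0 (c : K) hc))) : ℂ) *
        LFunctions.idealPow K (fun v => χ.valueAtUniformizer v) (Ideal.span {c}) := by
  -- notation and basic facts (as in `isRayClassCharacter_of_isModulus`)
  have hb0 : b ≠ 0 := fun h => hb (by rw [h]; rfl)
  have hc0 : c ≠ 0 := fun h => hc (by rw [h]; rfl)
  set bu : Kˣ := Units.mk0 (b : K) hb with hbu
  set cu : Kˣ := Units.mk0 (c : K) hc with hcu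
  have hbcop : IsCoprime (Ideal.span {b}) (modulusIdeal T e) := LFunctions.isCoprime_span_of_sub_mem hcop hbc
  have hcT : ∀ v ∈ T, c ∉ v.asIdeal := fun v hv hcv =>
    (LFunctions.isCoprime_iff_forall_not_le (modulusIdeal_ne_bot T e)).mp hcop v (modulusIdeal_le_iff.mpr hv)
      ((Ideal.span_singleton_le_iff_mem _).mpr hcv)
  have hbT : ∀ v ∈ T, b ∉ v.asIdeal := fun v hv hbv =>
    (LFunctions.isCoprime_iff_forall_not_le (modulusIdeal_ne_bot T e)).mp hbcop v (modulusIdeal_le_iff.mpr hv)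
      ((Ideal.span_singleton_le_iff_mem _).mpr hbv)
  have hvalb : ∀ v ∈ T, v.valuation K (b : K) = 1 := fun v hv =>
    (valuation_eq_one_iff_notMem (K := K) v).mpr (hbT v hv)
  have hvalc : ∀ v ∈ T, v.valuation K (c : K) = 1 := fun v hv =>
    (valuation_eq_one_iff_notMem (K := K) v).mpr (hcT v hv)
  -- the finite set `S ⊇ T` outside which `b` and `c` are units
  set S : Finset (HeightOneSpectrum (𝓞 K)) :=
    T ∪ (finite_setOf_valuation_coe_ne_one (K := K) hb0).toFinset ∪
      (finite_setOf_valuation_coe_ne_one (K := K) hc0).toFinset with hSdef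
  have hTS : T ⊆ S := Finset.subset_union_left.trans Finset.subset_union_left
  have hSb : ∀ v ∉ S, v.valuation K (b : K) = 1 := fun v hv => by
    by_contra h
    exact hv (Finset.mem_union_left _ (Finset.mem_union_right _ ((Set.Finite.mem_toFinset _).mpr h)))
  have hSc : ∀ v ∉ S, v.valuation K (c : K) = 1 := fun v hv => by
    by_contra h
    exact hv (Finset.mem_union_right _ ((Set.Finite.mem_toFinset _).mpr h))
  -- Neukirch's decomposition for `b` and `c`
  have hB := map_principalIdele_eq hmod bu hTS hSb
  have hC := map_principalIdele_eq hmod cu hTS hSc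
  -- the parts at `T` agree
  have hTpart : ∏ v ∈ T, χ (localUnits v (globalToLocalUnits v bu)) =
      ∏ v ∈ T, χ (localUnits v (globalToLocalUnits v cu)) := by
    have h1 := map_prod_localUnits_eq_one_of_isModulus hmod
      (fun v => globalToLocalUnits v bu * (globalToLocalUnits v cu)⁻¹) (fun v hv => ?_) (fun v hv => ?_)
    · simp only [map_mul, map_inv, Finset.prod_mul_distrib, Finset.prod_inv_distrib,
        mul_inv_eq_one, map_prod] at h1
      exact h1
    · rw [Units.val_mul, Units.val_inv_eq_inv_val, map_mul, map_inv₀, val_globalToLocalUnits,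
        val_globalToLocalUnits, valued_algebraMap_adicCompletion, valued_algebraMap_adicCompletion,
        hbu, hcu, Units.val_mk0, Units.val_mk0, hvalb v hv, hvalc v hv, inv_one, mul_one]
    · have hcv : Valued.v (algebraMap K (v.adicCompletion K) (c : K)) = 1 := by
        rw [valued_algebraMap_adicCompletion]; exact hvalc v hv
      have hc0' : algebraMap K (v.adicCompletion K) (c : K) ≠ 0 := (map_ne_zero _).2 hc
      have heq : ((globalToLocalUnits v bu * (globalToLocalUnits v cu)⁻¹ : (v.adicCompletion K)ˣ) :
          v.adicCompletion K) - 1 =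
          (algebraMap K (v.adicCompletion K) (b : K) - algebraMap K (v.adicCompletion K) (c : K)) *
            (algebraMap K (v.adicCompletion K) (c : K))⁻¹ := by
        rw [Units.val_mul, Units.val_inv_eq_inv_val, val_globalToLocalUnits, val_globalToLocalUnits,
          hbu, hcu, Units.val_mk0, Units.val_mk0, sub_mul, mul_inv_cancel₀ hc0']
      have hcast : (b : K) - (c : K) = algebraMap (𝓞 K) K (b - c) := by
        rw [map_sub]
      rw [heq, map_mul, map_inv₀, hcv, inv_one, mul_one, ← map_sub, valued_algebraMap_adicCompletion,
        hcast, valuation_of_algebraMap]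
      have hmem : b - c ∈ v.asIdeal ^ (e v + 1) :=
        Ideal.le_of_dvd (pow_dvd_modulusIdeal e hv) hbc
      calc v.intValuation (b - c) ≤ WithZero.exp (-((e v + 1 : ℕ) : ℤ)) :=
            (intValuation_le_pow_iff_mem v (b - c) (e v + 1)).mpr hmem
        _ ≤ WithZero.exp (-(e v : ℤ)) := WithZero.exp_le_exp.mpr (by push_cast; linarith)
  -- translate the local values off `T` into powers of `χ(ϖ_v)`
  have hval : ∀ {d : 𝓞 K} (hd : d ≠ 0) (du : Kˣ) (_ : (du : K) = d), ∀ v ∈ S \ T,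
      (χ (localUnits v (globalToLocalUnits v du)) : ℂ) =
        χ.valueAtUniformizer v ^ (Associates.mk v.asIdeal).count
          (Associates.mk (Ideal.span {d} : Ideal (𝓞 K))).factors := by
    intro d hd du hdu v hv
    have hvT : v ∉ T := (Finset.mem_sdiff.mp hv).2
    rw [(isUnramifiedAt_of_isModulus' hmod hvT).coe_map_localUnits_eq_zpow (globalToLocalUnits v du)
      (m := ((Associates.mk v.asIdeal).count (Associates.mk (Ideal.span {d} : Ideal (𝓞 K))).factors : ℤ))
      (by rw [val_globalToLocalUnits, hdu]; exact valued_coe_ringOfIntegers v hd), zpow_natCast]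
  have hprod : ∀ {d : 𝓞 K} (hd : d ≠ 0) (du : Kˣ) (_ : (du : K) = d)
      (_ : ∀ v ∈ T, d ∉ v.asIdeal) (_ : ∀ v ∉ S, v.valuation K (d : K) = 1),
      LFunctions.idealPow K (fun v => χ.valueAtUniformizer v) (Ideal.span {d}) =
        ((∏ v ∈ S \ T, χ (localUnits v (globalToLocalUnits v du)) : ℂˣ) : ℂ) := by
    intro d hd du hdu hdT hdS
    rw [Units.coe_prod, LFunctions.idealPow, finprod_eq_prod_of_mulSupport_subset _ (s := S \ T) ?_]
    · exact Finset.prod_congr rfl fun v hv => (hval hd du hdu v hv).symm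
    · intro v hv
      rw [Function.mem_mulSupport] at hv
      have hcnt : (Associates.mk v.asIdeal).count
          (Associates.mk (Ideal.span {d} : Ideal (𝓞 K))).factors ≠ 0 := fun h0 => hv (by rw [h0, pow_zero])
      have hdvd : v.asIdeal ∣ Ideal.span {d} :=
        (Associates.count_ne_zero_iff_dvd ((Submodule.ne_bot_iff _).mpr
          ⟨d, Ideal.mem_span_singleton_self d, hd⟩) v.irreducible).mp hcnt
      have hdv : d ∈ v.asIdeal := Ideal.dvd_span_singleton.mp hdvd
      rw [Finset.coe_sdiff, Set.mem_sdiff, Finset.mem_coe, Finset.mem_coe]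
      refine ⟨?_, fun hvT => hdT v hvT hdv⟩
      by_contra hvS
      have := hdS v hvS
      rw [valuation_eq_one_iff_notMem (K := K) v] at this
      exact this hdv
  -- the algebra, in `ℂ`
  rw [← Finset.prod_sdiff hTS, hTpart] at hB
  rw [← Finset.prod_sdiff hTS] at hC
  have h1 := congrArg Units.val hB
  have h2 := congrArg Units.val hC
  simp only [Units.val_mul, Units.val_one] at h1 h2
  set Ib : ℂ := (χ (infiniteIdeles K (globalToInfiniteUnits K bu)) : ℂ) with hIb
  set Ic : ℂ := (χ (infiniteIdeles K (globalToInfiniteUnits K cu)) : ℂ) with hIc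
  set Pb : ℂ := ((∏ v ∈ S \ T, χ (localUnits v (globalToLocalUnits v bu)) : ℂˣ) : ℂ) with hPb
  set Pc : ℂ := ((∏ v ∈ S \ T, χ (localUnits v (globalToLocalUnits v cu)) : ℂˣ) : ℂ) with hPc
  set PT : ℂ := ((∏ v ∈ T, χ (localUnits v (globalToLocalUnits v cu)) : ℂˣ) : ℂ) with hPT
  have hPT0 : PT ≠ 0 := Units.ne_zero _
  -- `h1 : Ib * (Pb * PT) = 1`, `h2 : Ic * (Pc * PT) = 1`
  have key : (Ib * Pb - Ic * Pc) * PT = 0 := by linear_combination h1 - h2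
  have hmain : Ib * Pb = Ic * Pc := by
    rcases mul_eq_zero.mp key with h | h
    · exact sub_eq_zero.mp h
    · exact absurd h hPT0
  rw [hprod hb0 bu rfl hbT hSb, hprod hc0 cu rfl hcT hSc]
  exact hmain

/-! ### §2. The ray `a ≡ 1 mod 𝔪`: `χ((a)_∞) · χ̃((a)) = 1` -/

/-- **Neukirch VII (6.13): `f ∘ δ = 1` — on the ray `a ≡ 1 mod 𝔪` the Größencharakter is the inverse
archimedean value.**  For a Hecke character `χ` of `K` with module of definition `(T, e)` and a nonzero
integer `a ≡ 1 mod 𝔪(T, e)`: `χ((a)_∞) · ∏_𝔭 χ(ϖ_𝔭)^{v_𝔭(a)} = 1`, i.e. `χ̃((a)) = χ((a)_∞)⁻¹` with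
`(a)_∞ = infiniteIdeles K (globalToInfiniteUnits K a)` the infinite part of the principal idele
(Neukirch's `χ_∞ = (χ|_{I_∞})⁻¹`, from `ψ(b) = b⁻¹`).  Case `c = 1` of §1.
[cite: NeukirchANT1999, Ch. VII §6 Prop. (6.13) (proof: `f(δ(a)) = 1`)] -/
theorem IsModulus.coe_apply_infiniteIdeles_mul_idealPow_span_eq_one {χ : HeckeCharacter K}
    {T : Finset (HeightOneSpectrum (𝓞 K))} {e : HeightOneSpectrum (𝓞 K) → ℕ} (hmod : IsModulus χ T e)
    {a : 𝓞 K} (ha : (a : K) ≠ 0) (ha1 : a - 1 ∈ modulusIdeal T e) :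
    (χ (infiniteIdeles K (globalToInfiniteUnits K (Units.mk0 (a : K) ha))) : ℂ) *
        LFunctions.idealPow K (fun v => χ.valueAtUniformizer v) (Ideal.span {a}) = 1 := by
  have h1K : ((1 : 𝓞 K) : K) ≠ 0 := by exact_mod_cast (one_ne_zero : (1 : K) ≠ 0)
  have hcop : IsCoprime (Ideal.span {(1 : 𝓞 K)}) (modulusIdeal T e) := by
    rw [Ideal.span_singleton_one, ← Ideal.one_eq_top]
    exact isCoprime_one_left
  have h := hmod.coe_apply_infiniteIdeles_mul_idealPow_span_eq (b := a) (c := 1) ha h1K hcop ha1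
  have hu : Units.mk0 ((1 : 𝓞 K) : K) h1K = 1 := Units.ext (by simp)
  have hR : (χ (infiniteIdeles K (globalToInfiniteUnits K (Units.mk0 ((1 : 𝓞 K) : K) h1K))) : ℂ) *
      LFunctions.idealPow K (fun v => χ.valueAtUniformizer v) (Ideal.span {(1 : 𝓞 K)}) = 1 := by
    rw [hu, map_one, map_one, map_one, Units.val_one, one_mul, Ideal.span_singleton_one,
      LFunctions.idealPow_top]
  rw [hR] at h
  exact h

/-- The same in `ℂˣ`-free "inverse" form: `χ̃((a)) = χ((a)_∞)⁻¹` on the ray.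
[cite: NeukirchANT1999, Ch. VII §6 Prop. (6.13) (proof: `f(δ(a)) = 1`)] -/
theorem IsModulus.idealPow_span_eq_inv_coe_apply_infiniteIdeles {χ : HeckeCharacter K}
    {T : Finset (HeightOneSpectrum (𝓞 K))} {e : HeightOneSpectrum (𝓞 K) → ℕ} (hmod : IsModulus χ T e)
    {a : 𝓞 K} (ha : (a : K) ≠ 0) (ha1 : a - 1 ∈ modulusIdeal T e) :
    LFunctions.idealPow K (fun v => χ.valueAtUniformizer v) (Ideal.span {a}) =
      ((χ (infiniteIdeles K (globalToInfiniteUnits K (Units.mk0 (a : K) ha))) : ℂ))⁻¹ := by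
  have h := hmod.coe_apply_infiniteIdeles_mul_idealPow_span_eq_one ha ha1
  exact eq_inv_of_mul_eq_one_right h

/-! ### §3. Integers prime to `𝔪`: the relation up to an `M`-th root of unity -/

/-- **`a^M ≡ 1 mod 𝔪` for `a` prime to `𝔪`**, `M = #(𝒪_K/𝔪)ˣ` (Lagrange in the finite group
`(𝒪_K/𝔪)ˣ`; the tree's `exists_unit_pow_sub_one_mem` is the case of global units).
[cite: NeukirchANT1999, Ch. VII §6 Prop. (6.13) (the group `(𝒪/𝔪)^*`)] -/
theorem pow_card_units_quotient_sub_one_mem {𝔪 : Ideal (𝓞 K)} (h𝔪 : 𝔪 ≠ ⊥) {a : 𝓞 K}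
    (ha : IsCoprime (Ideal.span {a}) 𝔪) :
    haveI : Finite (𝓞 K ⧸ 𝔪) := Ideal.finiteQuotientOfFreeOfNeBot 𝔪 h𝔪
    a ^ Nat.card (𝓞 K ⧸ 𝔪)ˣ - 1 ∈ 𝔪 := by
  haveI : Finite (𝓞 K ⧸ 𝔪) := Ideal.finiteQuotientOfFreeOfNeBot 𝔪 h𝔪
  obtain ⟨x, hx, y, hy, hxy⟩ := Ideal.isCoprime_iff_exists.mp ha
  obtain ⟨r, rfl⟩ := Ideal.mem_span_singleton'.mp hx
  -- `a` is a unit modulo `𝔪`, with inverse `r`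
  have hunit : Ideal.Quotient.mk 𝔪 a * Ideal.Quotient.mk 𝔪 r = 1 := by
    rw [← map_mul, mul_comm, ← (Ideal.Quotient.mk 𝔪).map_one, Ideal.Quotient.eq, ← neg_sub,
      Ideal.neg_mem_iff, show (1 : 𝓞 K) - r * a = y by linear_combination -hxy]
    exact hy
  set u : (𝓞 K ⧸ 𝔪)ˣ := Units.mkOfMulEqOne _ _ hunit with hu
  have h : u ^ Nat.card (𝓞 K ⧸ 𝔪)ˣ = 1 := pow_card_eq_one'
  have h' := congrArg Units.val h
  rw [Units.val_pow_eq_pow_val, hu, Units.val_mkOfMulEqOne, Units.val_one, ← map_pow] at h'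
  rw [← Ideal.Quotient.eq_zero_iff_mem, map_sub, map_one, h', sub_self]

/-- **Neukirch (6.13) up to an `M`-th root of unity, for ALL integers prime to `𝔪`.**  With
`M = #(𝒪_K/𝔪(T,e))ˣ`: for every nonzero `a ∈ 𝒪_K` prime to `𝔪`, `(χ((a)_∞) · χ̃((a)))^M = 1`
(apply §2 to `a^M ≡ 1 mod 𝔪`; both factors are multiplicative in `a`).  This is the form in which
Weil 1956 §1 uses the relation for units (`HeckeCharacterArchTypeProofs` §1), now for all `a` prime
to `𝔪`. [cite: NeukirchANT1999, Ch. VII §6 Prop. (6.13) (proof)] [cite: Weil1956, §1] -/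
theorem IsModulus.exists_pos_forall_pow_coe_apply_infiniteIdeles_mul_idealPow_eq_one
    {χ : HeckeCharacter K} {T : Finset (HeightOneSpectrum (𝓞 K))} {e : HeightOneSpectrum (𝓞 K) → ℕ}
    (hmod : IsModulus χ T e) :
    ∃ M : ℕ, 0 < M ∧ ∀ {a : 𝓞 K} (ha : (a : K) ≠ 0), IsCoprime (Ideal.span {a}) (modulusIdeal T e) →
      ((χ (infiniteIdeles K (globalToInfiniteUnits K (Units.mk0 (a : K) ha))) : ℂ) *
        LFunctions.idealPow K (fun v => χ.valueAtUniformizer v) (Ideal.span {a})) ^ M = 1 := by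
  haveI : Finite (𝓞 K ⧸ modulusIdeal T e) :=
    Ideal.finiteQuotientOfFreeOfNeBot _ (modulusIdeal_ne_bot T e)
  refine ⟨Nat.card (𝓞 K ⧸ modulusIdeal T e)ˣ, Nat.card_pos, fun {a} ha hcop => ?_⟩
  set M : ℕ := Nat.card (𝓞 K ⧸ modulusIdeal T e)ˣ with hM
  have ha0 : a ≠ 0 := fun h => ha (by rw [h]; rfl)
  have haM : ((a ^ M : 𝓞 K) : K) ≠ 0 := by
    rw [show ((a ^ M : 𝓞 K) : K) = (a : K) ^ M from by push_cast; rfl]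
    exact pow_ne_zero _ ha
  have hcong : a ^ M - 1 ∈ modulusIdeal T e :=
    pow_card_units_quotient_sub_one_mem (modulusIdeal_ne_bot T e) hcop
  have h := hmod.coe_apply_infiniteIdeles_mul_idealPow_span_eq_one haM hcong
  have hunits : Units.mk0 ((a ^ M : 𝓞 K) : K) haM = Units.mk0 (a : K) ha ^ M :=
    Units.ext (by push_cast; rfl)
  have hspan : Ideal.span {a ^ M} = (Ideal.span {a} : Ideal (𝓞 K)) ^ M :=
    (Ideal.span_singleton_pow a M).symm
  rw [hunits, map_pow, map_pow, map_pow, Units.val_pow_eq_pow_val, hspan,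
    LFunctions.idealPow_pow _ ((Ideal.span_singleton_eq_bot.not).mpr ha0), ← mul_pow] at h
  exact h

/-! ### §4. Principal primes: the Euler coefficient versus the archimedean value -/

/-- A prime `𝔭_w` off the support `T` of the module of definition is prime to `𝔪(T, e)`.
[cite: NeukirchANT1999, Ch. VII §6 (6.11)–(6.12) (`𝔭 ∤ 𝔪`)] -/
theorem isCoprime_asIdeal_modulusIdeal_of_not_mem {T : Finset (HeightOneSpectrum (𝓞 K))}
    (e : HeightOneSpectrum (𝓞 K) → ℕ) {w : HeightOneSpectrum (𝓞 K)} (hw : w ∉ T) :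
    IsCoprime w.asIdeal (modulusIdeal T e) := by
  refine (LFunctions.isCoprime_iff_forall_not_le (modulusIdeal_ne_bot T e)).mpr fun v hv hwv => ?_
  have hvw : v = w :=
    HeightOneSpectrum.ext (w.isMaximal.eq_of_le v.isPrime.ne_top hwv).symm
  exact hw (modulusIdeal_le_iff.mp (hvw ▸ hv))

/-- **At a principal prime `𝔭_w = (π)` off `T`: `(χ((π)_∞) · χ(ϖ_w))^M = 1`**, `M = #(𝒪_K/𝔪)ˣ` — the
Euler coefficient `χ(ϖ_w)` (`valueAtUniformizer`, `= χ̃(𝔭_w)` by `LFunctions.idealPow_asIdeal`) is the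
inverse archimedean value `χ((π)_∞)⁻¹` up to an `M`-th root of unity, for EVERY principal prime off
`T` with the SAME `M`.  (Neukirch (6.13) at `𝔞 = (π)`; for `K` of class number one every prime is of
this form.) [cite: NeukirchANT1999, Ch. VII §6 Prop. (6.13) (proof) and Cor. (6.14)] -/
theorem IsModulus.exists_pos_forall_pow_coe_apply_infiniteIdeles_mul_valueAtUniformizer_eq_one
    {χ : HeckeCharacter K} {T : Finset (HeightOneSpectrum (𝓞 K))} {e : HeightOneSpectrum (𝓞 K) → ℕ}
    (hmod : IsModulus χ T e) :
    ∃ M : ℕ, 0 < M ∧ ∀ {w : HeightOneSpectrum (𝓞 K)} (_ : w ∉ T) {π : 𝓞 K} (hπ : (π : K) ≠ 0),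
      Ideal.span {π} = w.asIdeal →
      ((χ (infiniteIdeles K (globalToInfiniteUnits K (Units.mk0 (π : K) hπ))) : ℂ) *
        χ.valueAtUniformizer w) ^ M = 1 := by
  obtain ⟨M, hM, h⟩ := hmod.exists_pos_forall_pow_coe_apply_infiniteIdeles_mul_idealPow_eq_one
  refine ⟨M, hM, fun {w} hw {π} hπ hspan => ?_⟩
  have hcop : IsCoprime (Ideal.span {π}) (modulusIdeal T e) := by
    rw [hspan]; exact isCoprime_asIdeal_modulusIdeal_of_not_mem e hw
  have := h hπ hcop
  rwa [hspan, LFunctions.idealPow_asIdeal] at this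

/-- **At a principal prime `𝔭_w = (π)` with `π ≡ 1 mod 𝔪`: `χ((π)_∞) · χ(ϖ_w) = 1` exactly.**
[cite: NeukirchANT1999, Ch. VII §6 Prop. (6.13) (proof) and Cor. (6.14)] -/
theorem IsModulus.coe_apply_infiniteIdeles_mul_valueAtUniformizer_eq_one {χ : HeckeCharacter K}
    {T : Finset (HeightOneSpectrum (𝓞 K))} {e : HeightOneSpectrum (𝓞 K) → ℕ} (hmod : IsModulus χ T e)
    {w : HeightOneSpectrum (𝓞 K)} {π : 𝓞 K} (hπ : (π : K) ≠ 0) (hspan : Ideal.span {π} = w.asIdeal)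
    (hπ1 : π - 1 ∈ modulusIdeal T e) :
    (χ (infiniteIdeles K (globalToInfiniteUnits K (Units.mk0 (π : K) hπ))) : ℂ) *
      χ.valueAtUniformizer w = 1 := by
  have h := hmod.coe_apply_infiniteIdeles_mul_idealPow_span_eq_one hπ hπ1
  rwa [hspan, LFunctions.idealPow_asIdeal] at h

/-- **Module-free packaging**: every Hecke character `χ` admits a finite set `T` of finite places
(its ramified places will do) and `M ≥ 1` such that `(χ((π)_∞) · χ(ϖ_w))^M = 1` for every principal
prime `𝔭_w = (π)` with `w ∉ T` (`exists_isModulus_of_ramified` + §4).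
[cite: NeukirchANT1999, Ch. VII §6 (6.11)–(6.14)] -/
theorem exists_finset_pos_forall_pow_coe_apply_infiniteIdeles_mul_valueAtUniformizer_eq_one
    (χ : HeckeCharacter K) :
    ∃ (T : Finset (HeightOneSpectrum (𝓞 K))) (M : ℕ), 0 < M ∧ (∀ w ∉ T, χ.IsUnramifiedAt w) ∧
      ∀ {w : HeightOneSpectrum (𝓞 K)} (_ : w ∉ T) {π : 𝓞 K} (hπ : (π : K) ≠ 0),
        Ideal.span {π} = w.asIdeal →
        ((χ (infiniteIdeles K (globalToInfiniteUnits K (Units.mk0 (π : K) hπ))) : ℂ) *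
          χ.valueAtUniformizer w) ^ M = 1 := by
  obtain ⟨T, e, hmod⟩ := χ.exists_isModulus
  obtain ⟨M, hM, h⟩ := hmod.exists_pos_forall_pow_coe_apply_infiniteIdeles_mul_valueAtUniformizer_eq_one
  exact ⟨T, M, hM, fun w hw => isUnramifiedAt_of_isModulus' hmod hw, fun hw _ hπ hspan => h hw hπ hspan⟩

end HeckeCharacter

end Literature.NumberTheory.GaloisRepresentations
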